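import Mathlib.Combinatorics.SetFamily.Compression.Down
import Mathlib.Tactic
import HarnessLib
import HarnessLib.Audit.Tags
import Summits.CriticalPhenomena.PercolationContinuityZ3.Theorems.PercNearOneGluingNoHeavyLowerTailSahiRainbowTwoColourDeficitMixL

/-!
# The sparse residual is LOCAL, IV: two S₁-points have one of three shapes; three S₁-points do not exist

Support file (seat `prim-masterthm-p1`, gen 42; `--supports stmt-CriticalPhenomena-4575`).  No `sorry`, standard axioms.
Blueprint `run/shared/lean/prim/prim-masterthm/FROM-prim-masterthm-p1-g42-*.md` (PROOFS §3).

SETTING (`…SahiRainbowTwoColourDeficitDefs`): `Z = X ⊔ Y ⊆ 2^G` complement-closed, `L = monoMeets X Y`; S₁-points `y_i`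
with upper members `P_i ∈ X`, `Q_i ∈ Y` (`S1At X Y G y_i P_i Q_i`).

THIS FILE.
* PAIR LEMMA (`S1At.pair11`, `S1At.pair00`, `S1At.pair01`): for two S₁-points `y₁ ≠ y₂` (and a third point of `G`):
  - `y₂ ∈ P₁`, `y₁ ∈ P₂` ⟹ `P₂ = insert y₂ Q₁` (so `P₁ ∩ P₂ = {y₁, y₂}`, `P₁ ∪ P₂ = G`);
  - `y₂ ∉ P₁`, `y₁ ∉ P₂` ⟹ `P₂ = G ∖ P₁`;
  - `y₂ ∉ P₁`, `y₁ ∈ P₂` ⟹ `Q₁ ∖ y₁, P₁ ∖ y₁ ∈ Y` and (dually) `P₂ ∖ y₂, Q₂ ∖ y₂ ∈ X`.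
* **`S1At.false_of_three`: three distinct S₁-points cannot coexist.**
HONEST FRAMING: unconditional combinatorial lemmas (the local three-direction analysis of the sparse residual). [this work]
-/

namespace Summit.CriticalPhenomena.PercolationContinuityZ3.Theorems.SahiColouredDaykin

open Finset
open scoped FinsetFamily

variable {α : Type*} [DecidableEq α]

/-! ### 1. Two S₁-points -/

section Pair

variable {X Y : Finset (Finset α)} {G : Finset α} {y₁ y₂ : α} {P₁ Q₁ P₂ Q₂ : Finset α}

/-- If another `X`-upper member passes through `y₁`, then `y₁` has no collision below `P₁`: `P₁ ∖ y₁ ∈ Y`. [this work] -/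
theorem S1At.erase_P_mem_right (h₁ : S1At X Y G y₁ P₁ Q₁) (h₂ : S1At X Y G y₂ P₂ Q₂) (hne : y₁ ≠ y₂)
    (hG3 : ∃ t ∈ G, t ≠ y₁ ∧ t ≠ y₂) (hy₁ : y₁ ∈ P₂) : P₁.erase y₁ ∈ Y := by
  rcases mem_union.1 h₁.erase_P with hX | hY
  · exact (h₁.false_of_Lx_memX hX hne hG3 h₂.memP h₂.y_mem_P h₂.erase_P hy₁).elim
  · exact hY

/-- **Pair lemma, case (1,1).**  `y₂ ∈ P₁`, `y₁ ∈ P₂` ⟹ `P₂ = insert y₂ Q₁`. [this work] -/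
theorem S1At.pair11 (h₁ : S1At X Y G y₁ P₁ Q₁) (h₂ : S1At X Y G y₂ P₂ Q₂) (hne : y₁ ≠ y₂)
    (hG3 : ∃ t ∈ G, t ≠ y₁ ∧ t ≠ y₂) (hy₂ : y₂ ∈ P₁) (hy₁ : y₁ ∈ P₂) : P₂ = insert y₂ Q₁ := by
  have hG3' : ∃ t ∈ G, t ≠ y₂ ∧ t ≠ y₁ := by obtain ⟨t, ht, h1, h2⟩ := hG3; exact ⟨t, ht, h2, h1⟩
  have hP2e : P₂.erase y₂ ∈ Y := h₂.erase_P_mem_right h₁ hne.symm hG3' hy₂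
  by_contra hneq
  have ne1 : Q₁ ≠ P₂.erase y₂ := fun e => hneq (by rw [e, insert_erase h₂.y_mem_P])
  have hy₁GP : y₁ ∉ G \ P₁ := fun h => (mem_sdiff.1 h).2 h₁.y_mem_P
  have hy₂GP : y₂ ∉ G \ P₁ := fun h => (mem_sdiff.1 h).2 hy₂
  have c'_mem : Q₁ ∩ P₂.erase y₂ ∈ monoMeets X Y := inter_mem_monoMeets_right h₁.memQ hP2e ne1
  have e1 : Q₁ ∩ P₂.erase y₂ = insert y₁ ((G \ P₁) ∩ P₂) := by
    rw [h₁.Q_eq, insert_inter_of_mem (mem_erase.2 ⟨hne, hy₁⟩), inter_erase, erase_eq_of_notMem]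
    exact fun h => hy₂GP (mem_inter.1 h).1
  rw [e1] at c'_mem
  have c_mem : (G \ P₁) ∩ P₂ ∈ monoMeets X Y := by
    have hsP : G \ P₁ ∈ X ∪ Y := h₁.erase_Q_eq ▸ h₁.erase_Q
    rcases mem_union.1 hsP with hX | hY
    · have := inter_mem_monoMeets_left (Y := Y) h₂.memP hX (fun e => hy₁GP (e ▸ hy₁))
      rwa [inter_comm] at this
    · have ne : G \ P₁ ≠ P₂.erase y₂ := fun e => hy₁GP (e ▸ mem_erase.2 ⟨hne, hy₁⟩)
      have := inter_mem_monoMeets_right (X := X) hY hP2e ne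
      rwa [inter_erase, erase_eq_of_notMem (fun h => hy₂GP (mem_inter.1 h).1)] at this
  have hc := h₁.noTwin c_mem c'_mem (fun h => hy₁GP (mem_inter.1 h).1)
  rw [hc, insert_empty] at c'_mem
  exact h₁.singleton_notMem c'_mem

/-- **Pair lemma, case (0,0).**  `y₂ ∉ P₁`, `y₁ ∉ P₂` ⟹ `P₂ = G ∖ P₁`. [this work] -/
theorem S1At.pair00 (h₁ : S1At X Y G y₁ P₁ Q₁) (h₂ : S1At X Y G y₂ P₂ Q₂) (hne : y₁ ≠ y₂)
    (hG3 : ∃ t ∈ G, t ≠ y₁ ∧ t ≠ y₂) (hy₂ : y₂ ∉ P₁) (hy₁ : y₁ ∉ P₂) : P₂ = G \ P₁ := by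
  have hy₂Q : y₂ ∈ Q₁ := h₁.mem_Q_of_notMem_P (h₂.P_subset h₂.y_mem_P) hy₂
  have hy₁Q : y₁ ∈ Q₂ := h₂.mem_Q_of_notMem_P (h₁.P_subset h₁.y_mem_P) hy₁
  have hQ₂ : Q₂ = insert y₂ P₁ := h₁.swap.pair11 h₂.swap hne hG3 hy₂Q hy₁Q
  have : G \ P₂ = P₁ := by rw [← h₂.erase_Q_eq, hQ₂, erase_insert hy₂]
  rw [← this, Finset.sdiff_sdiff_eq_self h₂.P_subset]

/-- **Pair lemma, case (0,1)**, first half: `y₂ ∉ P₁`, `y₁ ∈ P₂` ⟹ `Q₁ ∖ y₁ ∈ Y` and `P₁ ∖ y₁ ∈ Y`. [this work] -/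
theorem S1At.pair01 (h₁ : S1At X Y G y₁ P₁ Q₁) (h₂ : S1At X Y G y₂ P₂ Q₂) (hne : y₁ ≠ y₂)
    (hG3 : ∃ t ∈ G, t ≠ y₁ ∧ t ≠ y₂) (hy₂ : y₂ ∉ P₁) (hy₁ : y₁ ∈ P₂) :
    Q₁.erase y₁ ∈ Y ∧ P₁.erase y₁ ∈ Y := by
  refine ⟨?_, h₁.erase_P_mem_right h₂ hne hG3 hy₁⟩
  rcases mem_union.1 h₁.erase_Q with hX | hY
  swap
  · exact hY
  exfalso
  have hy₂G : y₂ ∈ G := h₂.P_subset h₂.y_mem_P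
  have hy₂GP₁ : y₂ ∈ G \ P₁ := mem_sdiff.2 ⟨hy₂G, hy₂⟩
  have hy₁GP₂ : y₁ ∉ G \ P₂ := fun h => (mem_sdiff.1 h).2 hy₁
  have hy₂GP₂ : y₂ ∉ G \ P₂ := fun h => (mem_sdiff.1 h).2 h₂.y_mem_P
  have hy₁Q₂ : y₁ ∉ Q₂ := h₂.notMem_Q hy₁ hne
  rw [h₁.erase_Q_eq] at hX
  have hQQ : Q₁ ≠ Q₂ := fun e => hy₁Q₂ (e ▸ h₁.y_mem_Q)
  have QQ_mem : Q₁ ∩ Q₂ ∈ monoMeets X Y := inter_mem_monoMeets_right h₁.memQ h₂.memQ hQQ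
  have e1 : Q₁ ∩ Q₂ = insert y₂ ((G \ P₁) ∩ (G \ P₂)) := by
    rw [h₁.Q_eq, insert_inter_of_notMem hy₁Q₂, h₂.Q_eq, inter_insert_of_mem hy₂GP₁]
  rw [e1] at QQ_mem
  have c_mem : (G \ P₁) ∩ (G \ P₂) ∈ monoMeets X Y := by
    have hsP₂ : G \ P₂ ∈ X ∪ Y := h₂.erase_Q_eq ▸ h₂.erase_Q
    rcases mem_union.1 hsP₂ with hX' | hY'
    · exact inter_mem_monoMeets_left hX hX' (fun e => hy₂GP₂ (e ▸ hy₂GP₁))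
    · have ne : Q₁ ≠ G \ P₂ := fun e => hy₁GP₂ (e ▸ h₁.y_mem_Q)
      have := inter_mem_monoMeets_right (X := X) h₁.memQ hY' ne
      rwa [h₁.Q_eq, insert_inter_of_notMem hy₁GP₂] at this
  have hc := h₂.noTwin c_mem QQ_mem (fun h => hy₂GP₂ (mem_inter.1 h).2)
  rw [hc, insert_empty] at QQ_mem
  exact h₂.singleton_notMem QQ_mem

/-- **Pair lemma, case (0,1)**, second half (dual): `y₂ ∉ P₁`, `y₁ ∈ P₂` ⟹ `P₂ ∖ y₂ ∈ X` and `Q₂ ∖ y₂ ∈ X`. [this work] -/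
theorem S1At.pair01' (h₁ : S1At X Y G y₁ P₁ Q₁) (h₂ : S1At X Y G y₂ P₂ Q₂) (hne : y₁ ≠ y₂)
    (hG3 : ∃ t ∈ G, t ≠ y₁ ∧ t ≠ y₂) (hy₂ : y₂ ∉ P₁) (hy₁ : y₁ ∈ P₂) :
    P₂.erase y₂ ∈ X ∧ Q₂.erase y₂ ∈ X := by
  have hG3' : ∃ t ∈ G, t ≠ y₂ ∧ t ≠ y₁ := by obtain ⟨t, ht, h1, h2⟩ := hG3; exact ⟨t, ht, h2, h1⟩
  have hy₁Q₂ : y₁ ∉ Q₂ := h₂.notMem_Q hy₁ hne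
  have hy₂Q₁ : y₂ ∈ Q₁ := h₁.mem_Q_of_notMem_P (h₂.P_subset h₂.y_mem_P) hy₂
  exact h₂.swap.pair01 h₁.swap hne.symm hG3' hy₁Q₂ hy₂Q₁

end Pair

/-! ### 2. Three S₁-points -/

section Triple

variable {X Y : Finset (Finset α)} {G : Finset α} {y₁ y₂ y₃ : α} {P₁ Q₁ P₂ Q₂ P₃ Q₃ : Finset α}

/-- Three S₁-points with a mixed pair (`y₂ ∉ P₁`, `y₁ ∈ P₂`): absurd. [this work] -/
theorem S1At.false_of_three_c (hXY : Disjoint X Y) (h₁ : S1At X Y G y₁ P₁ Q₁) (h₂ : S1At X Y G y₂ P₂ Q₂)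
    (h₃ : S1At X Y G y₃ P₃ Q₃) (h12 : y₁ ≠ y₂) (h13 : y₁ ≠ y₃) (h23 : y₂ ≠ y₃) (hm₁₂ : y₂ ∉ P₁) (hm₂₁ : y₁ ∈ P₂) :
    False := by
  have hy₁G : y₁ ∈ G := h₁.P_subset h₁.y_mem_P
  have hy₂G : y₂ ∈ G := h₂.P_subset h₂.y_mem_P
  have hy₃G : y₃ ∈ G := h₃.P_subset h₃.y_mem_P
  have g12 : ∃ t ∈ G, t ≠ y₁ ∧ t ≠ y₂ := ⟨y₃, hy₃G, h13.symm, h23.symm⟩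
  have g13 : ∃ t ∈ G, t ≠ y₁ ∧ t ≠ y₃ := ⟨y₂, hy₂G, h12.symm, h23⟩
  have g23 : ∃ t ∈ G, t ≠ y₂ ∧ t ≠ y₃ := ⟨y₁, hy₁G, h12, h13⟩
  have g31 : ∃ t ∈ G, t ≠ y₃ ∧ t ≠ y₁ := ⟨y₂, hy₂G, h23, h12.symm⟩
  have g32 : ∃ t ∈ G, t ≠ y₃ ∧ t ≠ y₂ := ⟨y₁, hy₁G, h13, h12⟩
  have dj : ∀ {s : Finset α}, s ∈ X → s ∈ Y → False := fun hX hY => disjoint_left.1 hXY hX hY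
  obtain ⟨Ly1, nLx1⟩ := h₁.pair01 h₂ h12 g12 hm₁₂ hm₂₁
  obtain ⟨Lx2, nLy2⟩ := h₁.pair01' h₂ h12 g12 hm₁₂ hm₂₁
  have hy₂Q₁ : y₂ ∈ Q₁ := h₁.mem_Q_of_notMem_P hy₂G hm₁₂
  by_cases m₁₃ : y₃ ∈ P₁ <;> by_cases m₃₁ : y₁ ∈ P₃
  · -- (1,1) for (1,3): `P₃ = insert y₃ Q₁ ∋ y₂`
    have hP₃ := h₁.pair11 h₃ h13 g13 m₁₃ m₃₁
    have m₃₂ : y₂ ∈ P₃ := by rw [hP₃]; exact mem_insert_of_mem hy₂Q₁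
    by_cases m₂₃ : y₃ ∈ P₂
    · have hP₃' := h₂.pair11 h₃ h23 g23 m₂₃ m₃₂
      have : y₁ ∈ Q₂ := by
        have := m₃₁; rw [hP₃', mem_insert] at this
        rcases this with h | h
        · exact absurd h h13
        · exact h
      exact h₂.notMem_Q hm₂₁ h12 this
    · exact dj nLy2 (h₂.pair01 h₃ h23 g23 m₂₃ m₃₂).1
  · -- (1,0) for (1,3): dual facts at `y₁` contradict `P₁ ∖ y₁ ∈ Y`
    exact dj (h₃.pair01' h₁ h13.symm g31 m₃₁ m₁₃).1 nLx1
  · -- (0,1) for (1,3): `y₃` is an Lx-point with `Q₃ ∖ y₃ ∈ X`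
    obtain ⟨Lx3, nLy3⟩ := h₁.pair01' h₃ h13 g13 m₁₃ m₃₁
    by_cases m₂₃ : y₃ ∈ P₂ <;> by_cases m₃₂ : y₂ ∈ P₃
    · have hP₃ := h₂.pair11 h₃ h23 g23 m₂₃ m₃₂
      have : P₃.erase y₃ = Q₂ := by rw [hP₃, erase_insert (h₂.notMem_Q m₂₃ h23.symm)]
      exact dj Lx3 (this ▸ h₂.memQ)
    · exact dj nLy3 (h₃.pair01 h₂ h23.symm g32 m₃₂ m₂₃).1
    · exact dj nLy2 (h₂.pair01 h₃ h23 g23 m₂₃ m₃₂).1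
    · have hP₃ := h₂.pair00 h₃ h23 g23 m₂₃ m₃₂
      have := m₃₁; rw [hP₃, mem_sdiff] at this
      exact this.2 hm₂₁
  · -- (0,0) for (1,3): `P₃ = G ∖ P₁ = Q₁ ∖ y₁ ∈ X`, contradicting `Q₁ ∖ y₁ ∈ Y`
    have hP₃ := h₁.pair00 h₃ h13 g13 m₁₃ m₃₁
    rw [← h₁.erase_Q_eq] at hP₃
    exact dj (hP₃ ▸ h₃.memP) Ly1

/-- Three S₁-points all of whose pairs are symmetric (`y_j ∈ P_i ↔ y_i ∈ P_j`): absurd. [this work] -/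
theorem S1At.false_of_three_sym (h₁ : S1At X Y G y₁ P₁ Q₁) (h₂ : S1At X Y G y₂ P₂ Q₂)
    (h₃ : S1At X Y G y₃ P₃ Q₃) (h12 : y₁ ≠ y₂) (h13 : y₁ ≠ y₃) (h23 : y₂ ≠ y₃)
    (c12 : y₂ ∈ P₁ ↔ y₁ ∈ P₂) (c13 : y₃ ∈ P₁ ↔ y₁ ∈ P₃) (c23 : y₃ ∈ P₂ ↔ y₂ ∈ P₃) : False := by
  have hy₁G : y₁ ∈ G := h₁.P_subset h₁.y_mem_P
  have hy₂G : y₂ ∈ G := h₂.P_subset h₂.y_mem_P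
  have hy₃G : y₃ ∈ G := h₃.P_subset h₃.y_mem_P
  have g12 : ∃ t ∈ G, t ≠ y₁ ∧ t ≠ y₂ := ⟨y₃, hy₃G, h13.symm, h23.symm⟩
  have g13 : ∃ t ∈ G, t ≠ y₁ ∧ t ≠ y₃ := ⟨y₂, hy₂G, h12.symm, h23⟩
  have g23 : ∃ t ∈ G, t ≠ y₂ ∧ t ≠ y₃ := ⟨y₁, hy₁G, h12, h13⟩
  by_cases m₁₂ : y₂ ∈ P₁ <;> by_cases m₁₃ : y₃ ∈ P₁ <;> by_cases m₂₃ : y₃ ∈ P₂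
  · -- (1,1,1)
    have hP₂ := h₁.pair11 h₂ h12 g12 m₁₂ (c12.1 m₁₂)
    have : y₃ ∈ insert y₂ Q₁ := hP₂ ▸ m₂₃
    rcases mem_insert.1 this with h | h
    · exact h23.symm h
    · exact h₁.notMem_Q m₁₃ h13.symm h
  · -- (1,1,0)
    have hP₃ := h₂.pair00 h₃ h23 g23 m₂₃ (fun h => m₂₃ (c23.2 h))
    exact (mem_sdiff.1 (hP₃ ▸ c13.1 m₁₃)).2 (c12.1 m₁₂)
  · -- (1,0,1)
    have hP₃ := h₁.pair00 h₃ h13 g13 m₁₃ (fun h => m₁₃ (c13.2 h))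
    exact (mem_sdiff.1 (hP₃ ▸ c23.1 m₂₃)).2 m₁₂
  · -- (1,0,0)
    have hP₃ := h₁.pair00 h₃ h13 g13 m₁₃ (fun h => m₁₃ (c13.2 h))
    have hP₃' := h₂.pair00 h₃ h23 g23 m₂₃ (fun h => m₂₃ (c23.2 h))
    have hP12 : P₁ = P₂ := by
      rw [← Finset.sdiff_sdiff_eq_self h₁.P_subset, ← hP₃, hP₃', Finset.sdiff_sdiff_eq_self h₂.P_subset]
    have hP₂ := h₁.pair11 h₂ h12 g12 m₁₂ (c12.1 m₁₂)
    have : y₃ ∈ P₁ := by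
      by_contra h
      have hQ := h₁.mem_Q_of_notMem_P hy₃G h
      apply h; rw [hP12, hP₂]; exact mem_insert_of_mem hQ
    exact m₁₃ this
  · -- (0,1,1)
    have hP₂ := h₁.pair00 h₂ h12 g12 m₁₂ (fun h => m₁₂ (c12.2 h))
    exact (mem_sdiff.1 (hP₂ ▸ m₂₃)).2 m₁₃
  · -- (0,1,0)
    have hP₂ := h₁.pair00 h₂ h12 g12 m₁₂ (fun h => m₁₂ (c12.2 h))
    have hP₃ := h₂.pair00 h₃ h23 g23 m₂₃ (fun h => m₂₃ (c23.2 h))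
    have hP13 : P₃ = P₁ := by rw [hP₃, hP₂, Finset.sdiff_sdiff_eq_self h₁.P_subset]
    have hP₃' := h₁.pair11 h₃ h13 g13 m₁₃ (c13.1 m₁₃)
    have : y₂ ∈ P₁ := by
      by_contra h
      have hQ := h₁.mem_Q_of_notMem_P hy₂G h
      apply h; rw [← hP13, hP₃']; exact mem_insert_of_mem hQ
    exact m₁₂ this
  · -- (0,0,1)
    have hP₂ := h₁.pair00 h₂ h12 g12 m₁₂ (fun h => m₁₂ (c12.2 h))
    have hP₃ := h₁.pair00 h₃ h13 g13 m₁₃ (fun h => m₁₃ (c13.2 h))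
    have hP23 : P₂ = P₃ := by rw [hP₂, hP₃]
    have hP₃' := h₂.pair11 h₃ h23 g23 m₂₃ (c23.1 m₂₃)
    have : y₁ ∈ P₂ := by
      by_contra h
      have hQ := h₂.mem_Q_of_notMem_P hy₁G h
      apply h; rw [hP23, hP₃']; exact mem_insert_of_mem hQ
    exact m₁₂ (c12.2 this)
  · -- (0,0,0)
    have hP₂ := h₁.pair00 h₂ h12 g12 m₁₂ (fun h => m₁₂ (c12.2 h))
    have hP₃ := h₁.pair00 h₃ h13 g13 m₁₃ (fun h => m₁₃ (c13.2 h))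
    have hP₃' := h₂.pair00 h₃ h23 g23 m₂₃ (fun h => m₂₃ (c23.2 h))
    have : y₃ ∈ G \ P₂ := hP₃' ▸ h₃.y_mem_P
    rw [hP₂, Finset.sdiff_sdiff_eq_self h₁.P_subset] at this
    exact m₁₃ this

/-- **THREE S₁-POINTS CANNOT COEXIST.** [this work] -/
theorem S1At.false_of_three (hXY : Disjoint X Y) (h₁ : S1At X Y G y₁ P₁ Q₁) (h₂ : S1At X Y G y₂ P₂ Q₂)
    (h₃ : S1At X Y G y₃ P₃ Q₃) (h12 : y₁ ≠ y₂) (h13 : y₁ ≠ y₃) (h23 : y₂ ≠ y₃) : False := by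
  -- a mixed pair `(i, j)` (`y_j ∉ P_i`, `y_i ∈ P_j`) is handled by `false_of_three_c`
  have mixed : ∀ {a b : Prop}, ¬ (a ↔ b) → (¬ a ∧ b) ∨ (a ∧ ¬ b) := by
    intro a b h; by_cases ha : a <;> by_cases hb : b <;> simp_all
  by_cases c12 : (y₂ ∈ P₁ ↔ y₁ ∈ P₂)
  swap
  · rcases mixed c12 with ⟨m, m'⟩ | ⟨m, m'⟩
    · exact h₁.false_of_three_c hXY h₂ h₃ h12 h13 h23 m m'
    · exact h₂.false_of_three_c hXY h₁ h₃ h12.symm h23 h13 m' m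
  by_cases c13 : (y₃ ∈ P₁ ↔ y₁ ∈ P₃)
  swap
  · rcases mixed c13 with ⟨m, m'⟩ | ⟨m, m'⟩
    · exact h₁.false_of_three_c hXY h₃ h₂ h13 h12 h23.symm m m'
    · exact h₃.false_of_three_c hXY h₁ h₂ h13.symm h23.symm h12 m' m
  by_cases c23 : (y₃ ∈ P₂ ↔ y₂ ∈ P₃)
  swap
  · rcases mixed c23 with ⟨m, m'⟩ | ⟨m, m'⟩
    · exact h₂.false_of_three_c hXY h₃ h₁ h23 h12.symm h13.symm m m'
    · exact h₃.false_of_three_c hXY h₂ h₁ h23.symm h13.symm h12.symm m' m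
  exact h₁.false_of_three_sym h₂ h₃ h12 h13 h23 c12 c13 c23

end Triple

end Summit.CriticalPhenomena.PercolationContinuityZ3.Theorems.SahiColouredDaykin
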